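import Mathlib
import Summits.NavierStokesRegularity.NavierStokesRegularity.Theorems.ScenarioCensusHelicalSlabLiouville
import HarnessLib

/-!
# Census rows S6 / S7: bounded periodic steady flows with mean-free radial velocity are constant

Support file for the scenario census of `NavierStokesRegularity` (cell `pub/ns-census`, block S).
The proof of row S6 (`HelicalSlab.helical_liouville`, Han–Wang–Xie 2023 Thm 1.1) uses the helical
symmetry only through (i) axial periodicity, (ii) the vanishing of the vertical period means of
the radial velocity `⟪x_h, U⟫` (HWX (A117)), (iii) "a helically symmetric constant is axial". This
file isolates the symmetry-free core, which is also the common core of Bang–Gui–Wang–Xie 2025,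
Thm 1.4 (a) (`u^θ` independent of `θ`) and (b) (`u^r` independent of `θ`) — row S7 of the census —
whose printed proofs (arXiv:2205.13259, §6 Steps 1–2) start from the same identity
`∫₀¹ r u^r dz = 0`:

* `periodicSlab_liouville_of_radial_verticalMean` — for `ν > 0`, `L > 0`: a smooth steady
  Navier–Stokes flow `(U, P)` on `ℝ³` (`IsLerayProfile ν 0 U P`, `U, P ∈ C^∞`), bounded, axially
  `L`-periodic, with `∫₀ᴸ ⟪x_h, U(x + s e₃)⟫ ds = 0` for every `x`, is a constant vector.

No summit statement and no census row is proved in this file.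

## References

* J. Han, Y. Wang, C. Xie, arXiv:2312.10382 (2023), §3. [HanWangXie2023]
* J. Bang, C. Gui, Y. Wang, C. Xie, J. Fluid Mech. 1005 (2025) A6 = arXiv:2205.13259, Thm 1.4,
  §6 Steps 1–2. [BangGuiWangXie2025]
-/

-- the summit and its single problem share the name (D-0017 nested layout)
set_option linter.dupNamespace false

noncomputable section

open MeasureTheory Set Function Filter InnerProductSpace
open scoped Topology ENNReal NNReal RealInnerProductSpace Laplacian ContDiff

namespace Summit.NavierStokesRegularity.NavierStokesRegularity.Theorems.ScenarioCensus.PeriodicSlab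

open Literature.Analysis Literature.Analysis.FluidPDE
open Summit.NavierStokesRegularity.NavierStokesRegularity.Theorems.ScenarioCensus.HelicalSlab

/-- **Bounded periodic steady flows with mean-free radial velocity are constant (unit
viscosity).** Let `(U, P)` be a smooth steady solution at `ν = 1` (`IsLerayProfile 1 0 U P`,
`U, P ∈ C^∞`) on `ℝ³`, bounded and axially `L`-periodic (`L > 0`), with
`∫₀ᴸ ⟪x_h, U(x + s e₃)⟫ ds = 0` for every `x`. Then `U` is a constant vector. -/
theorem periodicSlab_liouville_of_radial_verticalMean_one {L : ℝ} (hL : 0 < L)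
    {U : EuclideanSpace ℝ (Fin 3) → EuclideanSpace ℝ (Fin 3)} {P : EuclideanSpace ℝ (Fin 3) → ℝ}
    (hprof : IsLerayProfile 1 0 U P) (hU : ContDiff ℝ (⊤ : ℕ∞) U) (hP : ContDiff ℝ (⊤ : ℕ∞) P)
    (hbd : ∃ M : ℝ, ∀ x, ‖U x‖ ≤ M) (hper : IsAxiallyPeriodic L U)
    (hmean : ∀ x, ∫ s in (0 : ℝ)..L, ⟪horizPart x, U (x + s • eZ)⟫ = 0) :
    ∃ C : EuclideanSpace ℝ (Fin 3), U = fun _ => C := by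
  obtain ⟨M, hM⟩ := hbd
  have hst : IsSteadyClassicalNS 1 0 U P := isSteadyClassicalNS_of_isLerayProfile hprof hU hP
  -- periodic pressure, derivative bounds
  have hPper : IsAxiallyPeriodic L P := steady_pressure_periodic hL hst hM hper
  obtain ⟨K₁, K₂, K₃, -, -, -, hK⟩ := steady_derivative_bounds one_pos hst hM
  have hK₁ : ∀ x, ‖fderiv ℝ U x‖ ≤ K₁ := fun x => (hK x).1
  have hK₃ : ∀ x, ‖fderiv ℝ P x‖ ≤ K₃ := fun x => by
    have e : ‖fderiv ℝ P x‖ = ‖gradient P x‖ := by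
      rw [gradient]; exact ((InnerProductSpace.toDual ℝ (EuclideanSpace ℝ (Fin 3))).symm.norm_map _).symm
    rw [e]; exact (hK x).2.2
  have hU1 : ContDiff ℝ 1 U := contDiff_infty.1 hU 1
  have hUd : Differentiable ℝ U := hU1.differentiable one_ne_zero
  -- the period energies
  set F : EuclideanSpace ℝ (Fin 3) → ℝ := fun x => frobeniusNormSq (fderiv ℝ U x) with hF
  set E : ℝ → ℝ := fun r => ∫ x in zSlab L 0 ∩ {x | cylRadius x < r}, F x with hE
  have hFc : Continuous F := continuous_frobeniusNormSq_fderiv hU1 one_ne_zero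
  have hF0 : ∀ x, 0 ≤ F x := fun x => frobeniusNormSq_nonneg _
  set b := EuclideanSpace.basisFun (Fin 3) ℝ with hb
  have hFB' : ∀ x, F x ≤ 3 * K₁ ^ 2 := fun x => by
    show frobeniusNormSq (fderiv ℝ U x) ≤ 3 * K₁ ^ 2
    rw [frobeniusNormSq_eq_sum b]
    calc ∑ i, ‖fderiv ℝ U x (b i)‖ ^ 2 ≤ ∑ _i : Fin 3, K₁ ^ 2 := Finset.sum_le_sum fun i _ => by
          have h1 : ‖fderiv ℝ U x (b i)‖ ≤ K₁ := by
            calc ‖fderiv ℝ U x (b i)‖ ≤ ‖fderiv ℝ U x‖ * ‖b i‖ := ContinuousLinearMap.le_opNorm _ _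
              _ ≤ K₁ := by rw [b.orthonormal.1 i, mul_one]; exact hK₁ x
          exact pow_le_pow_left₀ (norm_nonneg _) h1 2
      _ = 3 * K₁ ^ 2 := by simp
  have hFB : ∀ x, ‖F x‖ ≤ 3 * K₁ ^ 2 := fun x => by
    rw [Real.norm_of_nonneg (hF0 x)]; exact hFB' x
  obtain ⟨a, c, ha, hc, hineq⟩ := helical_energy_dyadic_estimate hL hprof hU hP hper hPper hM hFB'
    hK₃ hmean E (fun r => rfl)
  have hFper : IsAxiallyPeriodic L F := fun x => by
    simp only [hF, isAxiallyPeriodic_fderiv hper x]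
  have hEint : ∀ r, 0 < r → IntegrableOn F (zSlab L 0 ∩ {x | cylRadius x < r}) volume :=
    fun r hr => integrableOn_zSlab_inter_cyl_of_bound hL hr hFc hFB
  have hmono : ∀ r s, 1 ≤ r → r ≤ s → E r ≤ E s := fun r s hr hrs =>
    setIntegral_mono_set (hEint s (by linarith)) (Eventually.of_forall fun x => hF0 x)
      (Eventually.of_forall fun x hx => ⟨hx.1, lt_of_lt_of_le hx.2 hrs⟩)
  have hE0 : ∀ r, 1 ≤ r → 0 ≤ E r := fun r _ =>
    setIntegral_nonneg ((measurableSet_zSlab L 0).inter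
      (isOpen_lt continuous_cylRadius continuous_const).measurableSet) fun x _ => hF0 x
  have hEA : ∀ r, 1 ≤ r → E r ≤ 3 * K₁ ^ 2 * (8 * L) * r ^ 2 := by
    intro r hr
    have hr0 : 0 < r := by linarith
    have hvol := volume_zSlab_inter_cyl_le hL hr0
    have hfin : volume (zSlab L 0 ∩ {x | cylRadius x < r}) ≠ ⊤ :=
      (lt_of_le_of_lt hvol ENNReal.ofReal_lt_top).ne
    have hmeas : MeasurableSet (zSlab L 0 ∩ {x : EuclideanSpace ℝ (Fin 3) | cylRadius x < r}) :=
      (measurableSet_zSlab L 0).inter (isOpen_lt continuous_cylRadius continuous_const).measurableSet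
    calc E r ≤ ∫ x in zSlab L 0 ∩ {x | cylRadius x < r}, (3 * K₁ ^ 2 : ℝ) := by
          refine setIntegral_mono_on (hEint r hr0) ?_ hmeas fun x _ => ?_
          · exact integrableOn_const hfin
          · exact hFB' x
      _ = (volume (zSlab L 0 ∩ {x | cylRadius x < r})).toReal * (3 * K₁ ^ 2) := by
          rw [setIntegral_const, smul_eq_mul, measureReal_def]
      _ ≤ (8 * L * r ^ 2) * (3 * K₁ ^ 2) :=
          mul_le_mul_of_nonneg_right (ENNReal.toReal_le_of_le_ofReal (by positivity) hvol)
            (by positivity)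
      _ = 3 * K₁ ^ 2 * (8 * L) * r ^ 2 := by ring
  -- `E ≡ 0`, `DU ≡ 0`, `U` constant
  have hEzero : ∀ r, 1 ≤ r → E r = 0 :=
    saintVenant_dyadic one_pos le_rfl ha hc hmono hE0 hEA hineq
  have hFzero : ∀ x, F x = 0 :=
    eq_zero_of_setIntegral_zSlab_eq_zero hL hFc hF0 hFper hFB hEzero
  have hDU : ∀ x, fderiv ℝ U x = 0 := fun x => eq_zero_of_frobeniusNormSq_eq_zero (hFzero x)
  exact ⟨U 0, funext fun x => is_const_of_fderiv_eq_zero hUd hDU x 0⟩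

/-- **Bounded periodic steady flows with mean-free radial velocity are constant**, any
viscosity `ν > 0` (scaling `(U, P) ↦ (ν⁻¹U, ν⁻²P)`). This is the common core of Han–Wang–Xie 2023
Thm 1.1 (row S6) and of Bang–Gui–Wang–Xie 2025 Thm 1.4 (a), (b) (row S7). -/
theorem periodicSlab_liouville_of_radial_verticalMean {ν L : ℝ} (hν : 0 < ν) (hL : 0 < L)
    {U : EuclideanSpace ℝ (Fin 3) → EuclideanSpace ℝ (Fin 3)} {P : EuclideanSpace ℝ (Fin 3) → ℝ}
    (hprof : IsLerayProfile ν 0 U P) (hU : ContDiff ℝ (⊤ : ℕ∞) U) (hP : ContDiff ℝ (⊤ : ℕ∞) P)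
    (hbd : ∃ M : ℝ, ∀ x, ‖U x‖ ≤ M) (hper : IsAxiallyPeriodic L U)
    (hmean : ∀ x, ∫ s in (0 : ℝ)..L, ⟪horizPart x, U (x + s • eZ)⟫ = 0) :
    ∃ C : EuclideanSpace ℝ (Fin 3), U = fun _ => C := by
  obtain ⟨M, hM⟩ := hbd
  set V : EuclideanSpace ℝ (Fin 3) → EuclideanSpace ℝ (Fin 3) := fun x => ν⁻¹ • U x with hV
  set Q : EuclideanSpace ℝ (Fin 3) → ℝ := fun x => ν⁻¹ ^ 2 • P x with hQ
  have hprof1 : IsLerayProfile 1 0 V Q := hprof.inv_smul_viscosity hν.ne'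
  have hVs : ContDiff ℝ (⊤ : ℕ∞) V := hU.const_smul ν⁻¹
  have hQs : ContDiff ℝ (⊤ : ℕ∞) Q := hP.const_smul (ν⁻¹ ^ 2)
  have hVbd : ∃ M' : ℝ, ∀ x, ‖V x‖ ≤ M' := ⟨|ν⁻¹| * M, fun x => by
    show ‖ν⁻¹ • U x‖ ≤ |ν⁻¹| * M
    rw [norm_smul, Real.norm_eq_abs]
    exact mul_le_mul_of_nonneg_left (hM x) (abs_nonneg _)⟩
  have hVper : IsAxiallyPeriodic L V := fun x => by
    show ν⁻¹ • U (x + L • EuclideanSpace.single 2 (1 : ℝ)) = ν⁻¹ • U x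
    rw [hper x]
  have hVmean : ∀ x, ∫ s in (0 : ℝ)..L, ⟪horizPart x, V (x + s • eZ)⟫ = 0 := fun x => by
    have e : (fun s : ℝ => ⟪horizPart x, V (x + s • eZ)⟫) =
        fun s : ℝ => ν⁻¹ * ⟪horizPart x, U (x + s • eZ)⟫ := by
      funext s; simp only [hV, real_inner_smul_right]
    rw [e, intervalIntegral.integral_const_mul, hmean x, mul_zero]
  obtain ⟨C, hC⟩ := periodicSlab_liouville_of_radial_verticalMean_one hL hprof1 hVs hQs hVbd hVper hVmean
  refine ⟨ν • C, funext fun x => ?_⟩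
  have hx : ν⁻¹ • U x = C := congrFun hC x
  have := congrArg (fun v => ν • v) hx
  simpa [smul_smul, mul_inv_cancel₀ hν.ne'] using this

end Summit.NavierStokesRegularity.NavierStokesRegularity.Theorems.ScenarioCensus.PeriodicSlab

end
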